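import Mathlib.Analysis.SpecialFunctions.Pow.Real
import Mathlib.Analysis.Calculus.Deriv.Pow
import Literature.NumberTheory.Transcendental.KZLogCalculusProofs
import Literature.NumberTheory.Transcendental.KZRayDilog
import Literature.NumberTheory.Transcendental.KZDominatedFamilyRelations
import Literature.NumberTheory.Transcendental.KZPeriodsProofs

/-!
# `OffTetraSectorKernel`, line `odd-hyperbolic-ladder`: the power substitution `s = t^k` on the
log band (`stub_bandPowerSubst`)

Stub `stub_bandPowerSubst` of the crux `OffTetraSectorKernel` (stmt-KontsevichZagierPeriods-10557,
route HyperbolicBloch). For `k ≥ 1` and real algebraic `a, b` put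
`g(s) = b / ((1 − s a)² + (s b)²)`. The log band `B = [{0 < s < 1, 1 ≤ u ≤ 1/s}, g(s)/u]` and its
pull-back `Bk = [{0 < t < 1, 1 ≤ u ≤ 1/t^k}, k t^{k−1} g(t^k)/u]` under the power substitution
`s = φ(t) = t^k` of the BASE `(0,1)` differ by ONE change-of-variables move (Kontsevich–Zagier's
rule 2)): `φ` maps `(0,1)` bijectively onto `(0,1)` (inverse `s ↦ s^{1/k}`),
`φ'(t) = k t^{k−1} > 0`, the fibre tops match (`1/t^k = (1/s) ∘ φ`) and the integrands match
(`k t^{k−1} g(t^k)/u = (g(φ t)/u) · |φ'(t)|`). The move is the tree lemma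
`KZ.of_sub_of_mem_relations_covLift` (the lift `(t, u) ↦ (φ t, u)` of a base change to the bands
`{1 ≤ u ≤ v t}`) fed with the one-variable data: the chart `Φ p = (fun _ => (p 0)^k)` of `ℝ¹` is a
`ℚ`-polynomial map, has derivative `(k (p 0)^{k−1}) • id` (determinant `k (p 0)^{k−1}`), and is
injective on `(0,1)` with image `(0,1)`. No definitions are introduced.

References: M. Kontsevich, D. Zagier, *Periods* (2001), §1.2 rule (2); J. Bochnak, M. Coste,
M.-F. Roy, *Real Algebraic Geometry* (1998), §2.2.
-/

noncomputable section

open Set MeasureTheory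
open Literature.NumberTheory.Transcendental
open Literature.ModelTheory.ExponentialFields (IsSemialgebraic)

namespace Summit.KontsevichZagierPeriods.HyperbolicBloch.OffTetraSectorKernel

/-- **Registered stub `stub_bandPowerSubst`** (rule (2), ONE move): the power substitution
`s = t^k` on the base of the band `[{0<s<1, 1 ≤ u ≤ 1/s}, g(s)/u]`
(`KZ.of_sub_of_mem_relations_covLift` with `Φ(t) = t^k` on `(0,1)`, derivative `k t^{k−1} • id`,
injective, image `(0,1)`, fibre bound `1/s ∘ Φ = 1/t^k`): the pulled-back band is
`[{0<t<1, 1 ≤ u ≤ 1/t^k}, k t^{k−1} g(t^k)/u]`, `g(s) = b/((1 − s a)² + (s b)²)`.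
[cite: KontsevichZagier2001, §1.2 rule (2)] -/
theorem stub_bandPowerSubst :
    ∀ (k : ℕ), 1 ≤ k → ∀ (a b : ℝ), IsAlgebraic ℚ a → IsAlgebraic ℚ b →
    ∀ (B Bk : KZ.IntegralRep 2),
      B.domain = {w | (0 < w 0 ∧ w 0 < 1) ∧ 1 ≤ w 1 ∧ w 1 ≤ 1 / w 0} →
      Set.EqOn B.integrand (fun w => b / ((1 - w 0 * a) ^ 2 + (w 0 * b) ^ 2) / w 1) B.domain →
      Bk.domain = {w | (0 < w 0 ∧ w 0 < 1) ∧ 1 ≤ w 1 ∧ w 1 ≤ 1 / w 0 ^ k} →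
      Set.EqOn Bk.integrand
        (fun w => k * w 0 ^ (k - 1) * (b / ((1 - w 0 ^ k * a) ^ 2 + (w 0 ^ k * b) ^ 2)) / w 1) Bk.domain →
      KZ.of Bk - KZ.of B ∈ KZ.relations := by
  intro k hk a b _ _ B Bk hBd hBi hBkd hBki
  have hk0 : k ≠ 0 := Nat.one_le_iff_ne_zero.mp hk
  -- the base `(0,1) ⊆ ℝ¹` is `ℚ`-semialgebraic
  have hσ : IsSemialgebraic ℚ {x : Fin 1 → ℝ | 0 < x 0 ∧ x 0 < 1} :=
    isSemialgebraic_unitInterval_fin_one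
  -- coordinates of the plane as a band over the line
  have hi0 : ∀ z : Fin 2 → ℝ, Fin.init z 0 = z 0 := fun z => rfl
  have hl1 : ∀ z : Fin 2 → ℝ, z (Fin.last 1) = z 1 := fun z => rfl
  have hs0 : ∀ (x : Fin 1 → ℝ) (t : ℝ), (Fin.snoc x t : Fin 2 → ℝ) 0 = x 0 := fun x t => rfl
  have hs1 : ∀ (x : Fin 1 → ℝ) (t : ℝ), (Fin.snoc x t : Fin 2 → ℝ) 1 = t := fun x t => rfl
  -- the chart `Φ p = (fun _ => (p 0)^k)` and its derivative `(k (p 0)^(k-1)) • id`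
  set Φ : (Fin 1 → ℝ) → (Fin 1 → ℝ) := fun x _ => x 0 ^ k with hΦ
  set Φ' : (Fin 1 → ℝ) → (Fin 1 → ℝ) →L[ℝ] (Fin 1 → ℝ) := fun x =>
    ((k : ℝ) * x 0 ^ (k - 1)) • ContinuousLinearMap.id ℝ (Fin 1 → ℝ) with hΦ'
  have hdet : ∀ x, (Φ' x).det = (k : ℝ) * x 0 ^ (k - 1) := fun x => by
    simp [hΦ', ContinuousLinearMap.det, LinearMap.det_smul]
  -- adapted from `…K2SymbolChains.ClausenPi.of_sub_of_mem_relations_covLift_one`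
  have hΦd : ∀ x ∈ {x : Fin 1 → ℝ | 0 < x 0 ∧ x 0 < 1},
      HasFDerivWithinAt Φ (Φ' x) {x : Fin 1 → ℝ | 0 < x 0 ∧ x 0 < 1} x := by
    intro x _
    refine HasFDerivAt.hasFDerivWithinAt ?_
    rw [hasFDerivAt_pi']
    intro i
    have h1 : HasFDerivAt (fun y : Fin 1 → ℝ => y 0 ^ k)
        (((k : ℝ) * x 0 ^ (k - 1)) •
          ContinuousLinearMap.proj (R := ℝ) (φ := fun _ : Fin 1 => ℝ) 0) x :=
      (hasDerivAt_pow k (x 0)).comp_hasFDerivAt x (hasFDerivAt_apply 0 x)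
    refine h1.congr_fderiv (ContinuousLinearMap.ext fun w => ?_)
    simp [hΦ', Fin.fin_one_eq_zero i]
  have hΦs : IsSemialgebraicMapOn ℚ {x : Fin 1 → ℝ | 0 < x 0 ∧ x 0 < 1} Φ :=
    IsSemialgebraicMapOn.of_forall hσ fun _ => by
      simpa [hΦ] using
        isSemialgebraicFunOn_aeval hσ ((MvPolynomial.X 0 : MvPolynomial (Fin 1) ℚ) ^ k)
  have hΦi : InjOn Φ {x : Fin 1 → ℝ | 0 < x 0 ∧ x 0 < 1} := by
    intro x hx y hy h
    have h0 : x 0 ^ k = y 0 ^ k := congrFun h 0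
    funext i
    rw [Fin.fin_one_eq_zero i]
    exact (pow_left_inj₀ hx.1.le hy.1.le hk0).mp h0
  have himage : Φ '' {x : Fin 1 → ℝ | 0 < x 0 ∧ x 0 < 1} = {x : Fin 1 → ℝ | 0 < x 0 ∧ x 0 < 1} := by
    ext y
    simp only [mem_image, mem_setOf_eq]
    constructor
    · rintro ⟨x, hx, rfl⟩
      exact ⟨pow_pos hx.1 k, pow_lt_one₀ hx.1.le hx.2 hk0⟩
    · intro hy
      refine ⟨fun _ => y 0 ^ ((k : ℝ)⁻¹), ⟨Real.rpow_pos_of_pos hy.1 _,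
        Real.rpow_lt_one hy.1.le hy.2 (by positivity)⟩, ?_⟩
      funext i
      rw [Fin.fin_one_eq_zero i]
      exact Real.rpow_inv_natCast_pow hy.1.le hk0
  refine KZ.of_sub_of_mem_relations_covLift hΦs hΦd hΦi (v := fun x => 1 / x 0 ^ k)
    (v' := fun y => 1 / y 0) (fun x _ => rfl) Bk B ?_ ?_ fun z hz => ?_
  · -- the source band `{0 < t < 1, 1 ≤ u ≤ 1/t^k}`
    rw [hBkd]
    ext z
    simp only [KZlog.mem_band, mem_setOf_eq, hi0, hl1]
  · -- the target band `{0 < s < 1, 1 ≤ u ≤ 1/s}` over the image `Φ (0,1) = (0,1)`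
    rw [hBd, himage]
    ext z
    simp only [KZlog.mem_band, mem_setOf_eq, hi0, hl1]
  · -- the pull-back identity `k t^{k-1} g(t^k)/u = (g(t^k)/u) · |k t^{k-1}|`
    have hz' : (0 < z 0 ∧ z 0 < 1) ∧ 1 ≤ z 1 ∧ z 1 ≤ 1 / z 0 ^ k := by
      rw [hBkd] at hz
      exact hz
    have ht : 0 < z 0 := hz'.1.1
    have hw : (Fin.snoc (Φ (Fin.init z)) (z (Fin.last 1)) : Fin 2 → ℝ) ∈ B.domain := by
      rw [hBd]
      simp only [mem_setOf_eq, hs0, hs1, hi0, hl1, hΦ]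
      exact ⟨⟨pow_pos ht k, pow_lt_one₀ ht.le hz'.1.2 hk0⟩, hz'.2⟩
    rw [hBki hz, hBi hw, hdet]
    simp only [hs0, hs1, hi0, hl1, hΦ]
    rw [abs_of_nonneg (by positivity)]
    ring

end Summit.KontsevichZagierPeriods.HyperbolicBloch.OffTetraSectorKernel

end
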